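import Literature.NumberTheory.LFunctions.TruncatedWeilFormSourceSideProofs
import Literature.Analysis.Fourier.FractalUncertaintyLemma32
import HarnessLib

/-!
# RH-FREE — «nothing here bears on the truth of RH»: proof of Groskin's admissibility lemma (arXiv:2607.02828, Lemma 2.2)

PROOF LAYER for `Literature/NumberTheory/LFunctions/TruncatedWeilFormTailOrder.lean` (statement
file, cell `rh-columns/lit`). Discharges the claim `Groskin2026.lemma_2_2`
(A. Groskin, *A finite Guinand–Weil dictionary and archimedean tail order for the truncated Weil
quadratic form*, arXiv:2607.02828v3, Lemma 2.2 «Admissibility», p. 4): for every `c > 1`, `N`,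
and real vector `v`, the induced test function `g_v(z) = ∫_{−Δ}^{Δ} ĝ_v(ξ) e^{2πizξ} dξ` is
entire, and `g_v(z) = O((1 + |Re z|)⁻²)` uniformly on every horizontal strip `|Im z| ≤ a`.

The proof is the printed one (p. 5: "The Volterra convolution of finite exponential polynomials is
entire in `ω`. Hence `ĝ_v` is compactly supported, continuous, piecewise smooth, and vanishes at
`±Δ` … The Paley–Wiener bound and the displayed decay follow by two integrations by parts"):

* `volterraKernel_eq_quadValue` / `contDiff_volterraKernel`: by the tree's finite source calculus
  `lemma_2_3_holds` (rh-lit-frontier-1; Lemma 2.3 with `α = 1`; `continuous_volterraKernel` is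
  cc-t9 g4's, `TruncatedWeilFormSourceSideProofs.lean`, imported BY NAME), `K_v(ω) = ⟨v, Q_{1,ω} v⟩` is a finite sum of the
  smooth real functions `(sin 2πωm − sin 2πωn)/(π(m − n))`, `2ω cos 2πωm`; hence `K_v` is `C^∞`
  and `K_v(0) = 0`;
* `continuous_fourierWeight`, `fourierWeight_eq_zero_of_lt`: `ĝ_v` is continuous (it vanishes at
  `±Δ` because `K_v(0) = 0`) and supported in `[−Δ, Δ]`, so `g_v` is entire by the tree's
  `Literature.Analysis.Fourier.differentiable_fourierLaplaceInv` (differentiation under the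
  integral sign);
* `testFunction_eq_integral_Icc`: by evenness of `ĝ_v`,
  `g_v(z) = ∫₀^Δ πK_v(1 − ξ/Δ) (e^{wξ} + e^{−wξ}) dξ`, `w = 2πiz`;
* `integral_mul_cexp_eq_ibp_twice`: two integrations by parts for a `C²` density against `e^{wξ}`;
  the first-order boundary terms of the two halves cancel (`K_v(0) = 0` at `ξ = Δ`, and the two
  values at `ξ = 0` agree), leaving `O(e^{2πaΔ}/|z|²)` on the strip, which together with the
  trivial bound near `Re z = 0` gives `C/(1 + |Re z|)²`.

No new definitions, no named facts; nothing here bears on the truth of RH.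
-/

noncomputable section

open Filter Set MeasureTheory Complex Finset Matrix
open scoped Real Topology

namespace Literature.NumberTheory.LFunctions

namespace Groskin2026

/-! ### The Volterra kernel in closed form; smoothness -/

/-- `d/dx [(1/π) sin(2πωx)] = 2ω cos(2πωx)`. [cite: Groskin2026, proof of Lemma 2.3 (p. 5)] -/
theorem hasDerivAt_singleFreq_one (ω x : ℝ) :
    HasDerivAt (fun y : ℝ ↦ 1 / π * Real.sin (2 * π * ω * y)) (2 * ω * Real.cos (2 * π * ω * x)) x := by
  have h : HasDerivAt (fun y : ℝ ↦ 2 * π * ω * y) (2 * π * ω) x := by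
    simpa using (hasDerivAt_id x).const_mul (2 * π * ω)
  refine ((h.sin).const_mul (1 / π)).congr_deriv ?_
  field_simp

/-- `deriv` form of `hasDerivAt_singleFreq_one`. [cite: Groskin2026, proof of Lemma 2.3 (p. 5)] -/
theorem deriv_singleFreq_one (ω x : ℝ) :
    deriv (fun y : ℝ ↦ 1 / π * Real.sin (2 * π * ω * y)) x = 2 * ω * Real.cos (2 * π * ω * x) :=
  (hasDerivAt_singleFreq_one ω x).deriv

/-- **`K_v` in closed form** (Lemma 2.3 with `α = 1`): `K_v(ω) = ⟨v, Q_{1,ω} v⟩`, the even-sector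
contraction of the divided-difference matrix of `x ↦ (1/π) sin(2πωx)`.
[cite: Groskin2026, Lemma 2.3 (p. 5)] -/
theorem volterraKernel_eq_quadValue (N : ℕ) (v : Fin (N + 1) → ℝ) (ω : ℝ) :
    volterraKernel N v ω =
      ((quadValue N v (dividedDiffMatrix (fun x ↦ 1 / π * Real.sin (2 * π * ω * x)) N) : ℝ) : ℂ) := by
  have h := lemma_2_3_holds N v 1 ω
  simpa using h.symm

/-- The explicit finite double sum for `K_v(ω)`:
`K_v(ω) = Σ_{m,n} u_m u_n k_{mn}(ω)`, `k_{mm}(ω) = 2ω cos 2πωm`,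
`k_{mn}(ω) = ((1/π) sin 2πωm − (1/π) sin 2πωn)/(m − n)` (`m ≠ n`).
[cite: Groskin2026, proof of Lemma 2.3 (p. 5)] -/
theorem volterraKernel_eq_sum (N : ℕ) (v : Fin (N + 1) → ℝ) (ω : ℝ) :
    volterraKernel N v ω =
      ((∑ m : idx N, evenEmbed N v m * ∑ n : idx N,
          (if ((m : ℤ)) = (n : ℤ) then 2 * ω * Real.cos (2 * π * ω * ((m : ℤ) : ℝ))
            else (1 / π * Real.sin (2 * π * ω * ((m : ℤ) : ℝ)) -
                1 / π * Real.sin (2 * π * ω * ((n : ℤ) : ℝ))) / (((m : ℤ) : ℝ) - ((n : ℤ) : ℝ))) *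
            evenEmbed N v n : ℝ) : ℂ) := by
  rw [volterraKernel_eq_quadValue]
  congr 1
  simp only [quadValue, dotProduct, Matrix.mulVec, dividedDiffMatrix, Matrix.of_apply,
    deriv_singleFreq_one]

/-- **`K_v` is smooth** ("the Volterra convolution of finite exponential polynomials is entire in
`ω`"). [cite: Groskin2026, proof of Lemma 2.2 (p. 5)] -/
theorem contDiff_volterraKernel (N : ℕ) (v : Fin (N + 1) → ℝ) :
    ContDiff ℝ (⊤ : ℕ∞) (volterraKernel N v) := by
  have hfun : volterraKernel N v = fun ω ↦
      ((∑ m : idx N, evenEmbed N v m * ∑ n : idx N,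
          (if ((m : ℤ)) = (n : ℤ) then 2 * ω * Real.cos (2 * π * ω * ((m : ℤ) : ℝ))
            else (1 / π * Real.sin (2 * π * ω * ((m : ℤ) : ℝ)) -
                1 / π * Real.sin (2 * π * ω * ((n : ℤ) : ℝ))) / (((m : ℤ) : ℝ) - ((n : ℤ) : ℝ))) *
            evenEmbed N v n : ℝ) : ℂ) := funext (volterraKernel_eq_sum N v)
  have hreal : ContDiff ℝ (⊤ : ℕ∞) (fun ω : ℝ ↦
      (∑ m : idx N, evenEmbed N v m * ∑ n : idx N,
          (if ((m : ℤ)) = (n : ℤ) then 2 * ω * Real.cos (2 * π * ω * ((m : ℤ) : ℝ))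
            else (1 / π * Real.sin (2 * π * ω * ((m : ℤ) : ℝ)) -
                1 / π * Real.sin (2 * π * ω * ((n : ℤ) : ℝ))) / (((m : ℤ) : ℝ) - ((n : ℤ) : ℝ))) *
            evenEmbed N v n : ℝ)) := by
    refine ContDiff.sum fun m _ ↦ ContDiff.mul contDiff_const ?_
    refine ContDiff.sum fun n _ ↦ ContDiff.mul ?_ contDiff_const
    split_ifs with h
    · fun_prop
    · fun_prop
  rw [hfun]
  exact Complex.ofRealCLM.contDiff.comp hreal

/-- `K_v(0) = 0`. [cite: Groskin2026, §2.1 (p. 3)] -/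
theorem volterraKernel_zero (N : ℕ) (v : Fin (N + 1) → ℝ) : volterraKernel N v 0 = 0 := by
  simp [volterraKernel]

/-! ### The Fourier weight: continuity, support, evenness -/

/-- `Δ = log c / 2π > 0` for `c > 1`. [cite: Groskin2026, §2.1 (p. 3)] -/
theorem bandwidth_pos {c : ℝ} (hc : 1 < c) : 0 < bandwidth c :=
  div_pos (Real.log_pos hc) (by positivity)

/-- `ĝ_v` is even. [cite: Groskin2026, §2.1 (p. 3): "The weight is even"] -/
theorem fourierWeight_neg (c : ℝ) (N : ℕ) (v : Fin (N + 1) → ℝ) (ξ : ℝ) :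
    fourierWeight c N v (-ξ) = fourierWeight c N v ξ := by
  simp [fourierWeight, abs_neg]

/-- `ĝ_v(ξ) = 0` for `|ξ| > Δ`. [cite: Groskin2026, §2.1 (p. 3)] -/
theorem fourierWeight_eq_zero_of_lt {c : ℝ} {N : ℕ} {v : Fin (N + 1) → ℝ} {ξ : ℝ}
    (h : bandwidth c < |ξ|) : fourierWeight c N v ξ = 0 := by
  simp [fourierWeight, not_le.2 h]

/-- On `[0, Δ]`, `ĝ_v(ξ) = π K_v(1 − ξ/Δ)`. [cite: Groskin2026, §2.1 (p. 3)] -/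
theorem fourierWeight_eq_of_mem_Icc {c : ℝ} {N : ℕ} {v : Fin (N + 1) → ℝ} {ξ : ℝ}
    (h : ξ ∈ Icc 0 (bandwidth c)) :
    fourierWeight c N v ξ = π * volterraKernel N v (1 - ξ / bandwidth c) := by
  rw [fourierWeight, abs_of_nonneg h.1, if_pos h.2]

/-- **`ĝ_v` is continuous** (it vanishes at `±Δ` since `K_v(0) = 0`).
[cite: Groskin2026, proof of Lemma 2.2 (p. 5)] -/
theorem continuous_fourierWeight {c : ℝ} (hc : 1 < c) (N : ℕ) (v : Fin (N + 1) → ℝ) :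
    Continuous (fourierWeight c N v) := by
  have hΔ := bandwidth_pos hc
  unfold fourierWeight
  refine continuous_if_le (by fun_prop) continuous_const ?_ continuous_const.continuousOn ?_
  · exact (continuous_const.mul ((continuous_volterraKernel N v).comp (by fun_prop))).continuousOn
  · intro ξ hξ
    rw [hξ, div_self hΔ.ne', sub_self, volterraKernel_zero, mul_zero]

/-- `ĝ_v` is integrable. [cite: Groskin2026, proof of Lemma 2.2 (p. 5)] -/
theorem integrable_fourierWeight {c : ℝ} (hc : 1 < c) (N : ℕ) (v : Fin (N + 1) → ℝ) :
    Integrable (fourierWeight c N v) := by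
  refine (continuous_fourierWeight hc N v).integrable_of_hasCompactSupport ?_
  refine HasCompactSupport.of_support_subset_isCompact (isCompact_Icc (a := -bandwidth c)
    (b := bandwidth c)) ?_
  intro ξ hξ
  rw [Function.mem_support] at hξ
  by_contra hmem
  apply hξ
  apply fourierWeight_eq_zero_of_lt
  rw [Set.mem_Icc, not_and_or, not_le, not_le] at hmem
  rcases hmem with h | h
  · rw [abs_of_neg (by linarith [bandwidth_pos hc])]; linarith
  · rw [abs_of_pos (by linarith [bandwidth_pos hc])]; exact h

/-! ### `g_v` is entire -/

/-- `g_v` as an integral over `ℝ`. [cite: Groskin2026, §2.1 (p. 3)] -/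
theorem testFunction_eq_integral {c : ℝ} (hc : 1 < c) (N : ℕ) (v : Fin (N + 1) → ℝ) (z : ℂ) :
    testFunction c N v z = ∫ ξ : ℝ, cexp (2 * π * I * z * ξ) * fourierWeight c N v ξ := by
  have hΔ := bandwidth_pos hc
  rw [testFunction, intervalIntegral.integral_of_le (by linarith)]
  rw [← integral_Icc_eq_integral_Ioc]
  rw [setIntegral_eq_integral_of_forall_compl_eq_zero]
  · congr 1
    funext ξ
    ring
  · intro ξ hξ
    rw [fourierWeight_eq_zero_of_lt, zero_mul]
    rw [Set.mem_Icc, not_and_or, not_le, not_le] at hξ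
    rcases hξ with h | h
    · rw [abs_of_neg (by linarith)]; linarith
    · rw [abs_of_pos (by linarith)]; exact h

/-- **`g_v` is entire** (Lemma 2.2, first clause). [cite: Groskin2026, Lemma 2.2 (p. 4)] -/
theorem differentiable_testFunction {c : ℝ} (hc : 1 < c) (N : ℕ) (v : Fin (N + 1) → ℝ) :
    Differentiable ℂ (testFunction c N v) := by
  have h := Literature.Analysis.Fourier.differentiable_fourierLaplaceInv
    (integrable_fourierWeight hc N v) (bandwidth_pos hc).le
    (fun ξ hξ ↦ fourierWeight_eq_zero_of_lt (c := c) (N := N) (v := v) hξ)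
  have hfun : testFunction c N v = fun z ↦ ∫ ξ : ℝ, cexp (2 * π * I * z * ξ) * fourierWeight c N v ξ :=
    funext (testFunction_eq_integral hc N v)
  rw [hfun]
  exact h

/-! ### Two integrations by parts against `e^{wξ}` -/

/-- `d/dx e^{wx} = w e^{wx}` along the real axis. [folklore] -/
private theorem hasDerivAt_cexp_mul_ofReal (w : ℂ) (x : ℝ) :
    HasDerivAt (fun y : ℝ ↦ cexp (w * y)) (w * cexp (w * x)) x := by
  have h1 : HasDerivAt (fun y : ℂ ↦ cexp (w * y)) (cexp (w * x) * (w * 1)) (x : ℂ) :=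
    ((hasDerivAt_id (x : ℂ)).const_mul w).cexp
  exact h1.comp_ofReal.congr_deriv (by ring)

/-- `d/dx (e^{wx}/w) = e^{wx}` (`w ≠ 0`). [folklore] -/
private theorem hasDerivAt_cexp_mul_div {w : ℂ} (hw : w ≠ 0) (x : ℝ) :
    HasDerivAt (fun y : ℝ ↦ cexp (w * y) / w) (cexp (w * x)) x :=
  ((hasDerivAt_cexp_mul_ofReal w x).div_const w).congr_deriv (by field_simp)

/-- **One integration by parts** against `e^{wx}`, `w ≠ 0`:
`∫_a^b Φ e^{wx} = [Φ e^{wx}/w]_a^b − (1/w)∫_a^b Φ' e^{wx}`.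
[cite: Groskin2026, proof of Lemma 2.2 (p. 5)] -/
theorem integral_mul_cexp_eq_ibp {Φ Φ' : ℝ → ℂ} (hΦ : ∀ x, HasDerivAt Φ (Φ' x) x)
    (hΦ'c : Continuous Φ') {w : ℂ} (hw : w ≠ 0) (a b : ℝ) :
    ∫ x in a..b, Φ x * cexp (w * x) =
      (Φ b * cexp (w * b) - Φ a * cexp (w * a)) / w
        - (1 / w) * ∫ x in a..b, Φ' x * cexp (w * x) := by
  have hv : ∀ x ∈ uIcc a b, HasDerivAt (fun y : ℝ ↦ cexp (w * y) / w) (cexp (w * x)) x :=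
    fun x _ ↦ hasDerivAt_cexp_mul_div hw x
  have hcont : Continuous fun x : ℝ ↦ cexp (w * x) := Complex.continuous_exp.comp (by fun_prop)
  have h := intervalIntegral.integral_mul_deriv_eq_deriv_mul (fun x _ ↦ hΦ x) hv
    (hΦ'c.intervalIntegrable a b) (hcont.intervalIntegrable a b)
  rw [h]
  have h2 : ∫ x in a..b, Φ' x * (cexp (w * x) / w) =
      (1 / w) * ∫ x in a..b, Φ' x * cexp (w * x) := by
    rw [← intervalIntegral.integral_const_mul]
    congr 1
    funext x
    ring
  rw [h2]
  ring

/-- **Two integrations by parts** against `e^{wx}`, `w ≠ 0`: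
`∫_a^b Φ e^{wx} = [Φ e^{wx}/w]_a^b − [Φ' e^{wx}/w²]_a^b + (1/w²)∫_a^b Φ'' e^{wx}`.
[cite: Groskin2026, proof of Lemma 2.2 (p. 5): "two integrations by parts"] -/
theorem integral_mul_cexp_eq_ibp_twice {Φ Φ' Φ'' : ℝ → ℂ} (hΦ : ∀ x, HasDerivAt Φ (Φ' x) x)
    (hΦ' : ∀ x, HasDerivAt Φ' (Φ'' x) x) (hΦ''c : Continuous Φ'') {w : ℂ} (hw : w ≠ 0)
    (a b : ℝ) :
    ∫ x in a..b, Φ x * cexp (w * x) =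
      (Φ b * cexp (w * b) - Φ a * cexp (w * a)) / w
        - (Φ' b * cexp (w * b) - Φ' a * cexp (w * a)) / w ^ 2
        + (1 / w ^ 2) * ∫ x in a..b, Φ'' x * cexp (w * x) := by
  have hΦ'c : Continuous Φ' := continuous_iff_continuousAt.2 fun x ↦ (hΦ' x).continuousAt
  rw [integral_mul_cexp_eq_ibp hΦ hΦ'c hw, integral_mul_cexp_eq_ibp hΦ' hΦ''c hw]
  field_simp
  ring

/-! ### The decay of `g_v` on horizontal strips -/

/-- Chain rule along the affine map `ξ ↦ 1 − ξ/Δ`. [folklore] -/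
private theorem hasDerivAt_comp_one_sub_div {K : ℝ → ℂ} {K' : ℂ} {Δ : ℝ} (ξ : ℝ)
    (hK : HasDerivAt K K' (1 - ξ / Δ)) :
    HasDerivAt (fun x : ℝ ↦ K (1 - x / Δ)) ((-(1 / Δ)) • K') ξ := by
  have hinner : HasDerivAt (fun x : ℝ ↦ 1 - x / Δ) (-(1 / Δ)) ξ :=
    ((hasDerivAt_id ξ).div_const Δ).const_sub 1
  exact hK.scomp ξ hinner

/-- The strip bound for the exponential kernel: `‖e^{2πizξ}‖ ≤ e^{2πΔa}` for `|ξ| ≤ Δ`,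
`|Im z| ≤ a`. [folklore] -/
private theorem norm_cexp_kernel_le {z : ℂ} {ξ Δ a : ℝ} (hξ : |ξ| ≤ Δ) (hz : |z.im| ≤ a) :
    ‖cexp (2 * π * I * z * ξ)‖ ≤ Real.exp (2 * π * Δ * a) := by
  rw [Complex.norm_exp, Real.exp_le_exp]
  have hre : (2 * π * I * z * ξ).re = -(2 * π * (z.im * ξ)) := by
    simp [Complex.mul_re, Complex.mul_im]; ring
  rw [hre]
  have h1 : -(z.im * ξ) ≤ a * Δ := by
    calc -(z.im * ξ) ≤ |z.im * ξ| := neg_le_abs _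
      _ = |z.im| * |ξ| := abs_mul _ _
      _ ≤ a * Δ := mul_le_mul hz hξ (abs_nonneg _) ((abs_nonneg _).trans hz)
  nlinarith [Real.pi_pos]

/-- **`g_v` folded onto `[0, Δ]`** (evenness of `ĝ_v`): with `w = 2πiz`,
`g_v(z) = ∫₀^Δ πK_v(1 − ξ/Δ) e^{−wξ} dξ + ∫₀^Δ πK_v(1 − ξ/Δ) e^{wξ} dξ`.
[cite: Groskin2026, §2.1 (p. 3): "The weight is even, hence `g_v` is even"] -/
theorem testFunction_eq_two_integrals {c : ℝ} (hc : 1 < c) (N : ℕ) (v : Fin (N + 1) → ℝ)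
    (z : ℂ) :
    testFunction c N v z =
      (∫ ξ in (0 : ℝ)..bandwidth c,
          (π * volterraKernel N v (1 - ξ / bandwidth c)) * cexp (-(2 * π * I * z) * ξ)) +
        ∫ ξ in (0 : ℝ)..bandwidth c,
          (π * volterraKernel N v (1 - ξ / bandwidth c)) * cexp ((2 * π * I * z) * ξ) := by
  have hΔ := bandwidth_pos hc
  have hcontf : Continuous fun ξ : ℝ ↦ fourierWeight c N v ξ * cexp (2 * π * I * z * ξ) :=
    (continuous_fourierWeight hc N v).mul (Complex.continuous_exp.comp (by fun_prop))
  rw [testFunction, ← intervalIntegral.integral_add_adjacent_intervals (b := 0)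
    (hcontf.intervalIntegrable _ _) (hcontf.intervalIntegrable _ _)]
  congr 1
  · have hneg : ∫ ξ in (-bandwidth c)..0, fourierWeight c N v ξ * cexp (2 * π * I * z * ξ) =
        ∫ ξ in (0 : ℝ)..bandwidth c,
          fourierWeight c N v (-ξ) * cexp (2 * π * I * z * ((-ξ : ℝ) : ℂ)) := by
      rw [intervalIntegral.integral_comp_neg
        (fun ξ : ℝ ↦ fourierWeight c N v ξ * cexp (2 * π * I * z * ξ)), neg_zero]
    rw [hneg]
    refine intervalIntegral.integral_congr fun ξ hξ ↦ ?_
    rw [uIcc_of_le hΔ.le] at hξ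
    simp only [fourierWeight_neg, fourierWeight_eq_of_mem_Icc hξ]
    congr 1
    push_cast
    ring_nf
  · refine intervalIntegral.integral_congr fun ξ hξ ↦ ?_
    rw [uIcc_of_le hΔ.le] at hξ
    simp only [fourierWeight_eq_of_mem_Icc hξ]

/-- **The trivial bound**: `‖g_v(z)‖ ≤ 2Δ · sup|ĝ_v| · e^{2πΔa}` on `|Im z| ≤ a`.
[cite: Groskin2026, proof of Lemma 2.2 (p. 5)] -/
theorem norm_testFunction_le_const {c : ℝ} (hc : 1 < c) (N : ℕ) (v : Fin (N + 1) → ℝ)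
    (a : ℝ) :
    ∃ C₀ : ℝ, 0 ≤ C₀ ∧ ∀ z : ℂ, |z.im| ≤ a → ‖testFunction c N v z‖ ≤ C₀ := by
  have hΔ := bandwidth_pos hc
  obtain ⟨M₀, hM₀⟩ := (isCompact_Icc (a := -bandwidth c) (b := bandwidth c)).exists_bound_of_continuousOn
    (continuous_fourierWeight hc N v).continuousOn
  have hM₀nn : 0 ≤ M₀ := (norm_nonneg _).trans (hM₀ 0 ⟨by linarith, by linarith⟩)
  refine ⟨M₀ * Real.exp (2 * π * bandwidth c * a) * |bandwidth c - -bandwidth c|,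
    by positivity, fun z hz ↦ ?_⟩
  rw [testFunction]
  refine intervalIntegral.norm_integral_le_of_norm_le_const fun ξ hξ ↦ ?_
  rw [uIoc_of_le (by linarith)] at hξ
  have hξ' : |ξ| ≤ bandwidth c := abs_le.2 ⟨by linarith [hξ.1], hξ.2⟩
  rw [norm_mul]
  exact mul_le_mul (hM₀ ξ ⟨by linarith [hξ.1], hξ.2⟩) (norm_cexp_kernel_le hξ' hz)
    (norm_nonneg _) hM₀nn

/-- **The Paley–Wiener bound by two integrations by parts**: on `|Im z| ≤ a`, `z ≠ 0`,
`‖g_v(z)‖ ≤ C₁/‖z‖²`. [cite: Groskin2026, proof of Lemma 2.2 (p. 5)] -/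
theorem norm_testFunction_le_div_sq {c : ℝ} (hc : 1 < c) (N : ℕ) (v : Fin (N + 1) → ℝ)
    (a : ℝ) :
    ∃ C₁ : ℝ, 0 ≤ C₁ ∧ ∀ z : ℂ, z ≠ 0 → |z.im| ≤ a → ‖testFunction c N v z‖ ≤ C₁ / ‖z‖ ^ 2 := by
  have hΔ := bandwidth_pos hc
  set Δ := bandwidth c with hΔdef
  set K := volterraKernel N v with hKdef
  have hK : ContDiff ℝ (⊤ : ℕ∞) K := contDiff_volterraKernel N v
  have hK1 := contDiff_infty_iff_deriv.mp hK
  have hK2 := contDiff_infty_iff_deriv.mp hK1.2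
  have hKd : ∀ y, HasDerivAt K (deriv K y) y := fun y ↦ (hK1.1 y).hasDerivAt
  have hK'd : ∀ y, HasDerivAt (deriv K) (deriv (deriv K) y) y := fun y ↦ (hK2.1 y).hasDerivAt
  have hK''c : Continuous (deriv (deriv K)) := hK2.2.continuous
  -- the density `Φ(ξ) = π K(1 − ξ/Δ)` and its first two derivatives
  set Φ : ℝ → ℂ := fun ξ ↦ π * K (1 - ξ / Δ) with hΦdef
  set Φ' : ℝ → ℂ := fun ξ ↦ π * ((-(1 / Δ)) • deriv K (1 - ξ / Δ)) with hΦ'def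
  set Φ'' : ℝ → ℂ := fun ξ ↦ π * ((-(1 / Δ)) • ((-(1 / Δ)) • deriv (deriv K) (1 - ξ / Δ)))
    with hΦ''def
  have hΦ : ∀ ξ, HasDerivAt Φ (Φ' ξ) ξ := fun ξ ↦
    (hasDerivAt_comp_one_sub_div ξ (hKd _)).const_mul (π : ℂ)
  have hΦ' : ∀ ξ, HasDerivAt Φ' (Φ'' ξ) ξ := fun ξ ↦
    ((hasDerivAt_comp_one_sub_div (K := deriv K) ξ (hK'd _)).const_smul (-(1 / Δ))).const_mul
      (π : ℂ)
  have hΦ''c : Continuous Φ'' := by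
    show Continuous fun ξ : ℝ ↦
      (π : ℂ) * ((-(1 / Δ)) • ((-(1 / Δ)) • deriv (deriv K) (1 - ξ / Δ)))
    fun_prop
  have hΦ'c : Continuous Φ' := continuous_iff_continuousAt.2 fun x ↦ (hΦ' x).continuousAt
  -- sup bounds on `[0, Δ]`
  obtain ⟨M₁, hM₁⟩ := (isCompact_Icc (a := (0 : ℝ)) (b := Δ)).exists_bound_of_continuousOn
    hΦ'c.continuousOn
  obtain ⟨M₂, hM₂⟩ := (isCompact_Icc (a := (0 : ℝ)) (b := Δ)).exists_bound_of_continuousOn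
    hΦ''c.continuousOn
  have hM₁nn : 0 ≤ M₁ := (norm_nonneg _).trans (hM₁ 0 ⟨le_rfl, hΔ.le⟩)
  have hM₂nn : 0 ≤ M₂ := (norm_nonneg _).trans (hM₂ 0 ⟨le_rfl, hΔ.le⟩)
  set E : ℝ := Real.exp (2 * π * Δ * a) with hEdef
  have hEpos : 0 < E := Real.exp_pos _
  have hΦΔ : Φ Δ = 0 := by
    simp only [hΦdef, div_self hΔ.ne', sub_self, hKdef, volterraKernel_zero, mul_zero]
  refine ⟨(4 * M₁ * E + 2 * (Δ * (M₂ * E))) / (4 * π ^ 2), by positivity, fun z hz0 hz ↦ ?_⟩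
  set w : ℂ := 2 * π * I * z with hwdef
  have hw : w ≠ 0 := by
    simp only [hwdef]
    exact mul_ne_zero (mul_ne_zero (mul_ne_zero two_ne_zero (by exact_mod_cast Real.pi_ne_zero))
      Complex.I_ne_zero) hz0
  have hnw : -w ≠ 0 := neg_ne_zero.2 hw
  have hnormw : ‖w‖ = 2 * π * ‖z‖ := by
    simp only [hwdef, norm_mul, Complex.norm_ofNat, Complex.norm_real, Real.norm_eq_abs,
      abs_of_pos Real.pi_pos, Complex.norm_I, mul_one]
  have hnormw2 : ‖w‖ ^ 2 = 4 * π ^ 2 * ‖z‖ ^ 2 := by rw [hnormw]; ring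
  have hzpos : 0 < ‖z‖ := norm_pos_iff.2 hz0
  have hw2pos : 0 < ‖w‖ ^ 2 := by rw [hnormw2]; positivity
  -- kernel bounds on `[0, Δ]`
  have hker : ∀ ξ ∈ Icc (0 : ℝ) Δ, ‖cexp (w * ξ)‖ ≤ E ∧ ‖cexp (-w * ξ)‖ ≤ E := by
    intro ξ hξ
    have hξ' : |ξ| ≤ Δ := abs_le.2 ⟨by linarith [hξ.1], hξ.2⟩
    have hξ'' : |(-ξ)| ≤ Δ := by rwa [abs_neg]
    constructor
    · have := norm_cexp_kernel_le (z := z) hξ' hz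
      rwa [show w * (ξ : ℂ) = 2 * π * I * z * ξ by simp only [hwdef]]
    · have := norm_cexp_kernel_le (z := z) hξ'' hz
      rwa [show -w * (ξ : ℂ) = 2 * π * I * z * ((-ξ : ℝ) : ℂ) by
        simp only [hwdef]; push_cast; ring]
  -- the second-order remainder `A(u) = −[Φ' e^{uξ}/u²]_0^Δ + (1/u²)∫_0^Δ Φ'' e^{uξ}`, `u = ±w`
  have hA : ∀ u : ℂ, (u = w ∨ u = -w) →
      ‖-((Φ' Δ * cexp (u * (Δ : ℂ)) - Φ' 0 * cexp (u * ((0 : ℝ) : ℂ))) / u ^ 2)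
          + 1 / u ^ 2 * ∫ ξ in (0 : ℝ)..Δ, Φ'' ξ * cexp (u * ξ)‖ ≤
        (2 * M₁ * E + Δ * (M₂ * E)) / ‖w‖ ^ 2 := by
    intro u huw
    have hnu : ‖u‖ = ‖w‖ := by rcases huw with h | h <;> simp [h]
    have hkerU : ∀ ξ ∈ Icc (0 : ℝ) Δ, ‖cexp (u * ξ)‖ ≤ E := by
      intro ξ hξ
      rcases huw with h | h
      · rw [h]; exact (hker ξ hξ).1
      · rw [h]; exact (hker ξ hξ).2
    have h0mem : (0 : ℝ) ∈ Icc (0 : ℝ) Δ := ⟨le_rfl, hΔ.le⟩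
    have hΔmem : Δ ∈ Icc (0 : ℝ) Δ := ⟨hΔ.le, le_rfl⟩
    have hB : ‖-((Φ' Δ * cexp (u * (Δ : ℂ)) - Φ' 0 * cexp (u * ((0 : ℝ) : ℂ))) / u ^ 2)‖ ≤
        2 * M₁ * E / ‖w‖ ^ 2 := by
      rw [norm_neg, norm_div, norm_pow, hnu]
      refine div_le_div_of_nonneg_right ?_ hw2pos.le
      calc ‖Φ' Δ * cexp (u * (Δ : ℂ)) - Φ' 0 * cexp (u * ((0 : ℝ) : ℂ))‖
          ≤ ‖Φ' Δ * cexp (u * (Δ : ℂ))‖ + ‖Φ' 0 * cexp (u * ((0 : ℝ) : ℂ))‖ := norm_sub_le _ _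
        _ ≤ M₁ * E + M₁ * E :=
            add_le_add
              ((norm_mul_le _ _).trans
                (mul_le_mul (hM₁ Δ hΔmem) (hkerU Δ hΔmem) (norm_nonneg _) hM₁nn))
              ((norm_mul_le _ _).trans
                (mul_le_mul (hM₁ 0 h0mem) (hkerU 0 h0mem) (norm_nonneg _) hM₁nn))
        _ = 2 * M₁ * E := by ring
    have hC : ‖1 / u ^ 2 * ∫ ξ in (0 : ℝ)..Δ, Φ'' ξ * cexp (u * ξ)‖ ≤
        Δ * (M₂ * E) / ‖w‖ ^ 2 := by
      rw [norm_mul, norm_div, norm_one, norm_pow, hnu, one_div, mul_comm, ← div_eq_mul_inv]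
      refine div_le_div_of_nonneg_right ?_ hw2pos.le
      have hint := intervalIntegral.norm_integral_le_of_norm_le_const (a := (0 : ℝ)) (b := Δ)
        (f := fun ξ : ℝ ↦ Φ'' ξ * cexp (u * ξ)) (C := M₂ * E) (fun ξ hξ ↦ by
          rw [uIoc_of_le hΔ.le] at hξ
          have hξ' : ξ ∈ Icc (0 : ℝ) Δ := ⟨hξ.1.le, hξ.2⟩
          exact (norm_mul_le _ _).trans
            (mul_le_mul (hM₂ ξ hξ') (hkerU ξ hξ') (norm_nonneg _) hM₂nn))
      rw [sub_zero, abs_of_pos hΔ] at hint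
      linarith
    calc _ ≤ ‖-((Φ' Δ * cexp (u * (Δ : ℂ)) - Φ' 0 * cexp (u * ((0 : ℝ) : ℂ))) / u ^ 2)‖
          + ‖1 / u ^ 2 * ∫ ξ in (0 : ℝ)..Δ, Φ'' ξ * cexp (u * ξ)‖ := norm_add_le _ _
      _ ≤ 2 * M₁ * E / ‖w‖ ^ 2 + Δ * (M₂ * E) / ‖w‖ ^ 2 := add_le_add hB hC
      _ = (2 * M₁ * E + Δ * (M₂ * E)) / ‖w‖ ^ 2 := by ring
  -- `g_v(z) = A(−w) + A(w)`: the first-order boundary terms cancel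
  have hsum : testFunction c N v z =
      (-((Φ' Δ * cexp (-w * (Δ : ℂ)) - Φ' 0 * cexp (-w * ((0 : ℝ) : ℂ))) / (-w) ^ 2)
          + 1 / (-w) ^ 2 * ∫ ξ in (0 : ℝ)..Δ, Φ'' ξ * cexp (-w * ξ))
        + (-((Φ' Δ * cexp (w * (Δ : ℂ)) - Φ' 0 * cexp (w * ((0 : ℝ) : ℂ))) / w ^ 2)
          + 1 / w ^ 2 * ∫ ξ in (0 : ℝ)..Δ, Φ'' ξ * cexp (w * ξ)) := by
    rw [testFunction_eq_two_integrals hc N v z]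
    change (∫ ξ in (0 : ℝ)..Δ, Φ ξ * cexp (-w * ξ)) + (∫ ξ in (0 : ℝ)..Δ, Φ ξ * cexp (w * ξ)) = _
    rw [integral_mul_cexp_eq_ibp_twice hΦ hΦ' hΦ''c hnw 0 Δ,
      integral_mul_cexp_eq_ibp_twice hΦ hΦ' hΦ''c hw 0 Δ, hΦΔ]
    simp only [zero_mul, zero_sub, Complex.ofReal_zero, mul_zero, Complex.exp_zero, mul_one]
    field_simp
    ring
  rw [hsum]
  calc _ ≤ ‖-((Φ' Δ * cexp (-w * (Δ : ℂ)) - Φ' 0 * cexp (-w * ((0 : ℝ) : ℂ))) / (-w) ^ 2)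
          + 1 / (-w) ^ 2 * ∫ ξ in (0 : ℝ)..Δ, Φ'' ξ * cexp (-w * ξ)‖
        + ‖-((Φ' Δ * cexp (w * (Δ : ℂ)) - Φ' 0 * cexp (w * ((0 : ℝ) : ℂ))) / w ^ 2)
          + 1 / w ^ 2 * ∫ ξ in (0 : ℝ)..Δ, Φ'' ξ * cexp (w * ξ)‖ := norm_add_le _ _
    _ ≤ (2 * M₁ * E + Δ * (M₂ * E)) / ‖w‖ ^ 2 + (2 * M₁ * E + Δ * (M₂ * E)) / ‖w‖ ^ 2 :=
        add_le_add (hA (-w) (Or.inr rfl)) (hA w (Or.inl rfl))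
    _ = (4 * M₁ * E + 2 * (Δ * (M₂ * E))) / (4 * π ^ 2) / ‖z‖ ^ 2 := by
        rw [hnormw2]
        field_simp
        ring

/-- **[Gr26] Lemma 2.2, decay clause**: on every horizontal strip `|Im z| ≤ a`,
`‖g_v(z)‖ ≤ C/(1 + |Re z|)²`. [cite: Groskin2026, Lemma 2.2 (p. 4)] -/
theorem norm_testFunction_le_strip {c : ℝ} (hc : 1 < c) (N : ℕ) (v : Fin (N + 1) → ℝ)
    (a : ℝ) :
    ∃ C : ℝ, ∀ z : ℂ, |z.im| ≤ a → ‖testFunction c N v z‖ ≤ C / (1 + |z.re|) ^ 2 := by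
  obtain ⟨C₀, hC₀nn, hC₀⟩ := norm_testFunction_le_const hc N v a
  obtain ⟨C₁, hC₁nn, hC₁⟩ := norm_testFunction_le_div_sq hc N v a
  refine ⟨4 * (C₀ + C₁), fun z hz ↦ ?_⟩
  have hden : 0 < (1 + |z.re|) ^ 2 := by positivity
  rw [le_div_iff₀ hden]
  by_cases hre : 1 ≤ |z.re|
  · have hz0 : z ≠ 0 := by
      intro h
      rw [h, Complex.zero_re, abs_zero] at hre
      linarith
    have h1 := hC₁ z hz0 hz
    have hzn : |z.re| ≤ ‖z‖ := Complex.abs_re_le_norm z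
    have hzpos : 0 < ‖z‖ ^ 2 := by positivity
    rw [le_div_iff₀ hzpos] at h1
    have h2 : (1 + |z.re|) ^ 2 ≤ 4 * ‖z‖ ^ 2 := by nlinarith [abs_nonneg z.re]
    calc ‖testFunction c N v z‖ * (1 + |z.re|) ^ 2
        ≤ ‖testFunction c N v z‖ * (4 * ‖z‖ ^ 2) :=
          mul_le_mul_of_nonneg_left h2 (norm_nonneg _)
      _ = 4 * (‖testFunction c N v z‖ * ‖z‖ ^ 2) := by ring
      _ ≤ 4 * C₁ := by linarith
      _ ≤ 4 * (C₀ + C₁) := by linarith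
  · push Not at hre
    have h0 := hC₀ z hz
    have h2 : (1 + |z.re|) ^ 2 ≤ 4 := by nlinarith [abs_nonneg z.re]
    calc ‖testFunction c N v z‖ * (1 + |z.re|) ^ 2
        ≤ C₀ * 4 := mul_le_mul h0 h2 hden.le hC₀nn
      _ ≤ 4 * (C₀ + C₁) := by linarith

/-! ### Assembly -/

/-- **[Gr26] Lemma 2.2 (Admissibility)**, discharging the claim `lemma_2_2`: `g_v` is entire and
`g_v(z) = O((1 + |Re z|)⁻²)` uniformly on every horizontal strip. PROVED (two integrations by
parts, as printed). [cite: Groskin2026, Lemma 2.2 (p. 4)] -/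
theorem lemma_2_2_holds : Groskin2026.lemma_2_2 := fun _c hc N v ↦
  ⟨differentiable_testFunction hc N v, fun a ↦ norm_testFunction_le_strip hc N v a⟩

end Groskin2026

end Literature.NumberTheory.LFunctions

end
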